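import Mathlib
import HarnessLib
import Summits.RiemannHypothesis.RiemannHypothesis.Theorems.DbrWallAntipersistencePrime

/-!
# DBR column, rung B-P(P1): anti-persistence of the zeta screw line up to mesh `log 2` —
# `Ψ(2s) < 2Ψ(s)` for every `0 < s ≤ log 2`

RH-FREE calculus inequality (LINE 1 of the label discipline): a theorem about the closed form (1.1) of Suzuki's
screw function `Ψ = Literature.NumberTheory.LFunctions.zetaScrew` with its prime terms `Λ(n)n^{−1/2}(t − log n)₊`,
`n ≤ 4`; NOT worded as, and not, progress toward RH («`Ψ(2s) < 2Ψ(s)` for all `s > 0`» stays a conjecture from data).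

Third step of the ladder `DbrWallAntipersistence` (`s ≤ (log 2)/2`, p440661) → `DbrWallAntipersistencePrime`
(`s ≤ (log 3)/2`, p443658) → here `s ≤ log 2` (`zetaScrew_two_mul_lt_two_mul_of_le_log_two`). New RH-FREE
identities of independent use:

* `zetaScrew_eq_closedForm_sub_primeSum` — for every `t ≥ 0`,
  `Ψ(t) = 8(cosh(t/2) − 1) − (A/2)t + Σ_k(1 − e^{−λ_k t})/λ_k² − φ(t)` (`φ = zetaScrewPrimeSum`, any `t`);
* `two_mul_zetaScrew_sub_eq_gap_add_primeSums` — for every `s ≥ 0`,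
  **`2Ψ(s) − Ψ(2s) = D(s) + φ(2s) − 2φ(s)`**: the two-point gap is the archimedean gap
  `D(s) = Σ_k(1−e^{−λ'_k s})²/λ'_k² − 4(e^{s/2}−1)²` plus prime RAMPS; between consecutive half-log-prime-powers it
  is `D` plus an affine function, hence CONCAVE once `s ≥ (log 2)/2` (`gap_add_prime_concave`), so positivity
  propagates from one certified value per breakpoint.

Here: piece `[(log 3)/2, log 2]` (`φ(2s)` carries `2` and `3`, `φ(s) = 0`), certificate at `s = log 2`
(`gap_add_primes_log_two_pos`: `r = e^{(log 2)/2}`, `r² = 2`, `e^{−λ'_k log 2} = r⁻¹4^{−(k+1)}`; twenty terms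
`≥ 0.2308` + tail `≥ (1−4^{−21})²/85`, `4(r−1)² < 0.686293`, prime terms `(log 2)²/√2 > 0.33972`,
`(log 3/√3)·log(4/3) > 0.18244`; numerically `F(log 2) = 0.0788`, margin `0.078`). Nothing here bears on the truth of RH.
References: M. Suzuki, J. Lond. Math. Soc. (2) 108 (2023) = arXiv:2206.03682, (1.1) [Suzuki2023]. -/

set_option linter.dupNamespace false

noncomputable section

open scoped BigOperators
open Set
namespace Summit.RiemannHypothesis.RiemannHypothesis.Theorems.DbrWall

open Literature.NumberTheory.LFunctions

/-! ### The general two-point identity `2Ψ(s) − Ψ(2s) = D(s) + φ(2s) − 2φ(s)` -/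

/-- (1.1) with the Lerch term summed termwise, for EVERY `t ≥ 0`:
`Ψ(t) = 8(cosh(t/2) − 1) − (A/2)t + Σ_k (1 − e^{−λ_k t})/λ_k² − φ(t)`. [cite: Suzuki2023, (1.1)] -/
theorem zetaScrew_eq_closedForm_sub_primeSum {t : ℝ} (ht : 0 ≤ t) :
    zetaScrew t = 8 * (Real.cosh (t / 2) - 1)
      - (Real.eulerMascheroniConstant + Real.pi / 2 + 3 * Real.log 2 + Real.log Real.pi) / 2 * t
      + (∑' k : ℕ, (1 - Real.exp (-((2 * k + 1 / 2) * t))) / (2 * (k : ℝ) + 1 / 2) ^ 2)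
      - zetaScrewPrimeSum t := by
  have key : zetaScrew t = 8 * (Real.cosh (t / 2) - 1)
      - (Real.eulerMascheroniConstant + Real.pi / 2 + 3 * Real.log 2 + Real.log Real.pi) / 2 * |t|
      + (∑' k : ℕ, (1 - Real.exp (-((2 * k + 1 / 2) * |t|))) / (2 * (k : ℝ) + 1 / 2) ^ 2)
      - zetaScrewPrimeSum t := by
    rw [zetaScrew_eq, hurwitzLerchQuarter]
    have hcosh : Real.exp (|t| / 2) + Real.exp (-(|t| / 2)) - 2 = 2 * (Real.cosh (t / 2) - 1) := by
      rw [← Real.cosh_abs (t / 2), Real.cosh_eq, abs_div, abs_two]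
      ring
    rw [hcosh, ← tsum_mul_left, ← (summable_one_div_nat_add_quarter_sq).tsum_sub
      ((summable_hurwitzLerchQuarter t).mul_left _), ← tsum_mul_left]
    have hterm : ∀ k : ℕ, (1 / 4 : ℝ) * (1 / ((k : ℝ) + 1 / 4) ^ 2
        - Real.exp (-(|t| / 2)) * (Real.exp (-(2 * |t| * k)) / ((k : ℝ) + 1 / 4) ^ 2))
        = (1 - Real.exp (-((2 * k + 1 / 2) * |t|))) / (2 * (k : ℝ) + 1 / 2) ^ 2 := by
      intro k
      have hk : (2 * (k : ℝ) + 1 / 2) ^ 2 = 4 * ((k : ℝ) + 1 / 4) ^ 2 := by ring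
      have hk0 : ((k : ℝ) + 1 / 4) ^ 2 ≠ 0 := by positivity
      rw [hk, show Real.exp (-((2 * k + 1 / 2) * |t|))
          = Real.exp (-(|t| / 2)) * Real.exp (-(2 * |t| * k)) by rw [← Real.exp_add]; ring_nf]
      field_simp
    rw [tsum_congr hterm]
    ring
  rwa [abs_of_nonneg ht] at key

/-- **The general two-point identity** (RH-FREE): for every `s ≥ 0`,
`2Ψ(s) − Ψ(2s) = Σ_k(1 − e^{−λ'_k s})²/λ'_k² − 4(e^{s/2} − 1)² + φ(2s) − 2φ(s)`, `λ'_k = 2k + 5/2`,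
`φ(t) = Σ_{n ≤ e^t} Λ(n)n^{−1/2}(t − log n)`. [folklore] -/
theorem two_mul_zetaScrew_sub_eq_gap_add_primeSums {s : ℝ} (hs : 0 ≤ s) :
    2 * zetaScrew s - zetaScrew (2 * s) =
      (∑' k : ℕ, (1 - Real.exp (-((2 * (k : ℝ) + 5 / 2) * s))) ^ 2 / (2 * (k : ℝ) + 5 / 2) ^ 2)
      - 4 * (Real.exp (s / 2) - 1) ^ 2 + zetaScrewPrimeSum (2 * s) - 2 * zetaScrewPrimeSum s := by
  rw [zetaScrew_eq_closedForm_sub_primeSum hs, zetaScrew_eq_closedForm_sub_primeSum (by linarith : 0 ≤ 2 * s)]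
  have h := two_mul_closedForm_sub hs
  linear_combination h

/-! ### The prime sum with two primes: `log 3 ≤ t ≤ log 4` -/

/-- For `log 3 ≤ t ≤ log 4`: `φ(t) = (log 2/√2)(t − log 2) + (log 3/√3)(t − log 3)`. [cite: Suzuki2023, (1.1)] -/
theorem zetaScrewPrimeSum_eq_of_log_three_le {t : ℝ} (h3 : Real.log 3 ≤ t) (h4 : t ≤ Real.log 4) :
    zetaScrewPrimeSum t = Real.log 2 / Real.sqrt 2 * (t - Real.log 2)
      + Real.log 3 / Real.sqrt 3 * (t - Real.log 3) := by
  have h23 : Real.log 2 < Real.log 3 := Real.log_lt_log (by norm_num) (by norm_num)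
  have ht0 : 0 < t := lt_of_lt_of_le (Real.log_pos (by norm_num : (1:ℝ) < 3)) h3
  have hM : Real.exp |t| ≤ ((4 : ℕ) : ℝ) := by
    rw [abs_of_pos ht0]
    calc Real.exp t ≤ Real.exp (Real.log 4) := Real.exp_le_exp.2 h4
      _ = 4 := Real.exp_log (by norm_num)
      _ = ((4 : ℕ) : ℝ) := by norm_num
  rw [zetaScrewPrimeSum_eq_sum_max hM, abs_of_pos ht0,
    show Finset.Icc (1 : ℕ) 4 = {1, 2, 3, 4} from by decide,
    Finset.sum_insert (by decide), Finset.sum_insert (by decide), Finset.sum_insert (by decide),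
    Finset.sum_singleton]
  have h1 : ArithmeticFunction.vonMangoldt 1 = 0 := ArithmeticFunction.vonMangoldt_apply_one
  have hΛ2 : ArithmeticFunction.vonMangoldt 2 = Real.log 2 := by
    rw [ArithmeticFunction.vonMangoldt_apply_prime Nat.prime_two]; norm_num
  have hΛ3 : ArithmeticFunction.vonMangoldt 3 = Real.log 3 := by
    rw [ArithmeticFunction.vonMangoldt_apply_prime Nat.prime_three]; norm_num
  have hm2 : max (t - Real.log ((2 : ℕ) : ℝ)) 0 = t - Real.log 2 := by
    push_cast; exact max_eq_left (by linarith)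
  have hm3 : max (t - Real.log ((3 : ℕ) : ℝ)) 0 = t - Real.log 3 := by
    push_cast; exact max_eq_left (by linarith)
  have hm4 : max (t - Real.log ((4 : ℕ) : ℝ)) 0 = 0 := by
    push_cast; exact max_eq_right (by linarith)
  rw [h1, hΛ2, hΛ3, hm2, hm3, hm4]
  push_cast
  ring

/-- **Two-point identity on `[(log 3)/2, log 2]`**: for `log 3 ≤ 2s ≤ log 4`,
`2Ψ(s) − Ψ(2s) = D(s) + (log 2/√2)(2s − log 2) + (log 3/√3)(2s − log 3)`. [folklore] -/
theorem two_mul_zetaScrew_sub_eq_gap_add_two_primes {s : ℝ} (h3 : Real.log 3 ≤ 2 * s)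
    (h4 : 2 * s ≤ Real.log 4) :
    2 * zetaScrew s - zetaScrew (2 * s) =
      (∑' k : ℕ, (1 - Real.exp (-((2 * (k : ℝ) + 5 / 2) * s))) ^ 2 / (2 * (k : ℝ) + 5 / 2) ^ 2)
      - 4 * (Real.exp (s / 2) - 1) ^ 2 + Real.log 2 / Real.sqrt 2 * (2 * s - Real.log 2)
      + Real.log 3 / Real.sqrt 3 * (2 * s - Real.log 3) := by
  have hl3 : 0 < Real.log 3 := Real.log_pos (by norm_num)
  have h44 : Real.log 4 = 2 * Real.log 2 := by
    rw [show (4 : ℝ) = 2 ^ 2 by norm_num, Real.log_pow]; norm_num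
  have hs0 : 0 ≤ s := by linarith
  have hs2 : |s| ≤ Real.log 2 := by rw [abs_of_nonneg hs0]; linarith
  rw [two_mul_zetaScrew_sub_eq_gap_add_primeSums hs0, zetaScrewPrimeSum_eq_of_log_three_le h3 h4,
    zetaScrewPrimeSum_eq_zero_of_abs_le_log_two hs2]
  ring

/-! ### The certificate at `s = log 2` -/

/-- `r := e^{(log 2)/2}` satisfies `r² = 2`, hence `1.414213 < r < 1.414214`. [folklore] -/
theorem exp_log_two_div_two_bounds :
    Real.exp (Real.log 2 / 2) ^ 2 = 2 ∧ (1.414213 : ℝ) < Real.exp (Real.log 2 / 2)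
      ∧ Real.exp (Real.log 2 / 2) < 1.414214 := by
  set r := Real.exp (Real.log 2 / 2) with hr
  have hr0 : 0 < r := Real.exp_pos _
  have hr2 : r ^ 2 = 2 := by
    rw [← Real.exp_nat_mul, show ((2 : ℕ) : ℝ) * (Real.log 2 / 2) = Real.log 2 by push_cast; ring,
      Real.exp_log two_pos]
  refine ⟨hr2, ?_, ?_⟩ <;> nlinarith

/-- The gap exponentials at `s = log 2`: `e^{−λ'_k log 2} = 4^{−(k+1)}·r⁻¹`, `r = e^{(log 2)/2}`. [folklore] -/
theorem exp_neg_lam_mul_log_two (k : ℕ) :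
    Real.exp (-((2 * (k : ℝ) + 5 / 2) * Real.log 2))
      = (1 / 4 : ℝ) ^ (k + 1) * (Real.exp (Real.log 2 / 2))⁻¹ := by
  set r := Real.exp (Real.log 2 / 2) with hr
  have hr2 := exp_log_two_div_two_bounds.1
  have h1 : Real.exp (-((2 * (k : ℝ) + 5 / 2) * Real.log 2)) = r⁻¹ ^ (4 * k + 5) := by
    rw [show (2 * (k : ℝ) + 5 / 2) * Real.log 2 = ((4 * k + 5 : ℕ) : ℝ) * (Real.log 2 / 2) by
      push_cast; ring, Real.exp_neg, Real.exp_nat_mul, inv_pow]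
  have h2 : r⁻¹ ^ (4 * k + 5) = ((r⁻¹ ^ 2) ^ 2) ^ (k + 1) * r⁻¹ := by ring
  have h3 : r⁻¹ ^ 2 = 1 / 2 := by rw [inv_pow, hr2, one_div]
  rw [h1, h2, h3]
  norm_num

/-- `log(4/3) > 0.28767` (eight terms of `−log(1 − 1/4)`). [folklore] -/
theorem log_four_thirds_gt : (0.28767 : ℝ) < Real.log (4 / 3) := by
  have hx : |(1 / 4 : ℝ)| < 1 := by rw [abs_of_pos (by norm_num)]; norm_num
  have h := Real.abs_log_sub_add_sum_range_le hx 8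
  have hlog : Real.log (1 - 1 / 4 : ℝ) = -Real.log (4 / 3) := by
    rw [show (1 - 1 / 4 : ℝ) = (4 / 3)⁻¹ by norm_num, Real.log_inv]
  rw [hlog, abs_of_pos (by norm_num : (0 : ℝ) < 1 / 4)] at h
  have h' := (abs_le.1 h).2
  simp only [Finset.sum_range_succ, Finset.sum_range_zero] at h'
  norm_num at h'
  linarith

/-- The prime terms at `s = log 2`: `(log 2/√2)·log 2 + (log 3/√3)·(2 log 2 − log 3) > 0.52216`. [folklore] -/
theorem prime_terms_log_two_gt :
    (0.52216 : ℝ) < Real.log 2 / Real.sqrt 2 * (2 * Real.log 2 - Real.log 2)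
      + Real.log 3 / Real.sqrt 3 * (2 * Real.log 2 - Real.log 3) := by
  have h43 : 2 * Real.log 2 - Real.log 3 = Real.log (4 / 3) := by
    rw [Real.log_div (by norm_num) (by norm_num), show (4 : ℝ) = 2 ^ 2 by norm_num, Real.log_pow]
    norm_num
  rw [h43, show 2 * Real.log 2 - Real.log 2 = Real.log 2 by ring]
  have hl2 := Real.log_two_gt_d9
  have hl43 := log_four_thirds_gt
  have hl3 : (1.09852 : ℝ) < Real.log 3 := by
    have h := log_three_halves_gt
    have : Real.log 3 = Real.log 2 + Real.log (3 / 2) := by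
      rw [Real.log_div (by norm_num) (by norm_num)]; ring
    linarith
  have hs2 : 0 < Real.sqrt 2 := Real.sqrt_pos.2 (by norm_num)
  have hs3 : 0 < Real.sqrt 3 := Real.sqrt_pos.2 (by norm_num)
  have hs2u : Real.sqrt 2 < 1.41422 := by
    have h := Real.sq_sqrt (show (0 : ℝ) ≤ 2 by norm_num)
    nlinarith [Real.sqrt_nonneg 2]
  have hs3u : Real.sqrt 3 < 1.73206 := by
    have h := Real.sq_sqrt (show (0 : ℝ) ≤ 3 by norm_num)
    nlinarith [Real.sqrt_nonneg 3]
  have hA : (0.33972 : ℝ) < Real.log 2 / Real.sqrt 2 * Real.log 2 := by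
    rw [div_mul_eq_mul_div, lt_div_iff₀ hs2]
    have hp : (0.6931471803 : ℝ) * 0.6931471803 ≤ Real.log 2 * Real.log 2 :=
      mul_le_mul hl2.le hl2.le (by norm_num) (by linarith)
    nlinarith
  have hB : (0.18244 : ℝ) < Real.log 3 / Real.sqrt 3 * Real.log (4 / 3) := by
    rw [div_mul_eq_mul_div, lt_div_iff₀ hs3]
    have hp : (1.09852 : ℝ) * 0.28767 ≤ Real.log 3 * Real.log (4 / 3) :=
      mul_le_mul hl3.le hl43.le (by norm_num) (by linarith)
    nlinarith
  linarith

/-- **`F(log 2) > 0`**: `D(log 2) + (log 2)²/√2 + (log 3/√3)·log(4/3) > 0` in certificate form (numerically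
`F(log 2) = −0.4434 + 0.5222 = 0.0788`). [folklore] -/
theorem gap_add_primes_log_two_pos :
    0 < (∑' k : ℕ, (1 - Real.exp (-((2 * (k : ℝ) + 5 / 2) * Real.log 2))) ^ 2
            / (2 * (k : ℝ) + 5 / 2) ^ 2)
        - 4 * (Real.exp (Real.log 2 / 2) - 1) ^ 2
        + Real.log 2 / Real.sqrt 2 * (2 * Real.log 2 - Real.log 2)
        + Real.log 3 / Real.sqrt 3 * (2 * Real.log 2 - Real.log 3) := by
  set r := Real.exp (Real.log 2 / 2) with hr
  have hr0 : 0 < r := Real.exp_pos _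
  obtain ⟨hr2, hr_lo, hr_hi⟩ := exp_log_two_div_two_bounds
  have hrinv : r⁻¹ ≤ 0.70711 := by
    rw [inv_eq_one_div, div_le_iff₀ hr0]; nlinarith
  have hrinv1 : r⁻¹ ≤ 1 := by
    rw [inv_eq_one_div, div_le_iff₀ hr0]; nlinarith
  have hrinv0 : 0 ≤ r⁻¹ := by positivity
  have hs0 : (0 : ℝ) ≤ Real.log 2 := Real.log_nonneg one_le_two
  simp only [exp_neg_lam_mul_log_two]
  have hS : Summable fun k : ℕ =>
      (1 - (1 / 4 : ℝ) ^ (k + 1) * r⁻¹) ^ 2 / (2 * (k : ℝ) + 5 / 2) ^ 2 := by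
    have := summable_gap_terms hs0
    simp only [exp_neg_lam_mul_log_two] at this
    exact this
  rw [← hS.sum_add_tsum_nat_add 20]
  have hterm : ∀ k : ℕ, (1 - (1 / 4 : ℝ) ^ (k + 1) * 0.70711) ^ 2 / (2 * (k : ℝ) + 5 / 2) ^ 2
      ≤ (1 - (1 / 4 : ℝ) ^ (k + 1) * r⁻¹) ^ 2 / (2 * (k : ℝ) + 5 / 2) ^ 2 := by
    intro k
    apply div_le_div_of_nonneg_right _ (by positivity)
    have hq0 : 0 ≤ (1 / 4 : ℝ) ^ (k + 1) := by positivity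
    have hq1 : (1 / 4 : ℝ) ^ (k + 1) ≤ 1 := pow_le_one₀ (by norm_num) (by norm_num)
    have hlo : 0 ≤ 1 - (1 / 4 : ℝ) ^ (k + 1) * 0.70711 := by nlinarith
    have hle : 1 - (1 / 4 : ℝ) ^ (k + 1) * 0.70711 ≤ 1 - (1 / 4 : ℝ) ^ (k + 1) * r⁻¹ := by
      nlinarith [mul_le_mul_of_nonneg_left hrinv hq0]
    exact pow_le_pow_left₀ hlo hle 2
  have hnum : (0.2308 : ℝ) ≤
      ∑ k ∈ Finset.range 20, (1 - (1 / 4 : ℝ) ^ (k + 1) * 0.70711) ^ 2 / (2 * (k : ℝ) + 5 / 2) ^ 2 := by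
    simp only [Finset.sum_range_succ, Finset.sum_range_zero]
    norm_num
  have hhead : (0.2308 : ℝ) ≤
      ∑ k ∈ Finset.range 20, (1 - (1 / 4 : ℝ) ^ (k + 1) * r⁻¹) ^ 2 / (2 * (k : ℝ) + 5 / 2) ^ 2 :=
    hnum.trans (Finset.sum_le_sum fun k _ => hterm k)
  -- the tail by telescoping
  have hT := Literature.Probability.LatticeModels.hasSum_telescope (show (0 : ℝ) < 85 / 4 by norm_num)
  have hTs : Summable fun k : ℕ =>
      (1 - (1 / 4 : ℝ) ^ 21) ^ 2 / 4 * (1 / (((k : ℝ) + 85 / 4) * ((k : ℝ) + 85 / 4 + 1))) :=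
    (hT.mul_left _).summable
  have hTval : ∑' k : ℕ, (1 - (1 / 4 : ℝ) ^ 21) ^ 2 / 4 * (1 / (((k : ℝ) + 85 / 4) * ((k : ℝ) + 85 / 4 + 1)))
      = (1 - (1 / 4 : ℝ) ^ 21) ^ 2 / 4 * (1 / (85 / 4)) := (hT.mul_left _).tsum_eq
  have htail : ∑' k : ℕ, (1 - (1 / 4 : ℝ) ^ 21) ^ 2 / 4 * (1 / (((k : ℝ) + 85 / 4) * ((k : ℝ) + 85 / 4 + 1)))
      ≤ ∑' k : ℕ, (1 - (1 / 4 : ℝ) ^ (k + 20 + 1) * r⁻¹) ^ 2 / (2 * ((k + 20 : ℕ) : ℝ) + 5 / 2) ^ 2 := by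
    refine hTs.tsum_le_tsum (fun k => ?_) ((summable_nat_add_iff 20).2 hS)
    have hq0 : 0 ≤ (1 / 4 : ℝ) ^ (k + 20 + 1) * r⁻¹ := by positivity
    have hq1 : (1 / 4 : ℝ) ^ (k + 20 + 1) * r⁻¹ ≤ (1 / 4 : ℝ) ^ 21 := by
      have h1 : (1 / 4 : ℝ) ^ (k + 20 + 1) ≤ (1 / 4 : ℝ) ^ 21 :=
        pow_le_pow_of_le_one (by norm_num) (by norm_num) (by omega)
      have h2 : (1 / 4 : ℝ) ^ (k + 20 + 1) * r⁻¹ ≤ (1 / 4 : ℝ) ^ (k + 20 + 1) * 1 :=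
        mul_le_mul_of_nonneg_left hrinv1 (by positivity)
      linarith
    have hnum0 : 0 ≤ 1 - (1 / 4 : ℝ) ^ 21 := by norm_num
    have hnum1 : (1 - (1 / 4 : ℝ) ^ 21) ^ 2 ≤ (1 - (1 / 4 : ℝ) ^ (k + 20 + 1) * r⁻¹) ^ 2 :=
      pow_le_pow_left₀ hnum0 (by linarith) 2
    have hk : (0 : ℝ) ≤ k := Nat.cast_nonneg k
    have hden : (2 * ((k + 20 : ℕ) : ℝ) + 5 / 2) ^ 2 ≤ 4 * (((k : ℝ) + 85 / 4) * ((k : ℝ) + 85 / 4 + 1)) := by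
      push_cast; nlinarith
    have hden0 : 0 < (2 * ((k + 20 : ℕ) : ℝ) + 5 / 2) ^ 2 := by positivity
    rw [show (1 - (1 / 4 : ℝ) ^ 21) ^ 2 / 4 * (1 / (((k : ℝ) + 85 / 4) * ((k : ℝ) + 85 / 4 + 1)))
        = (1 - (1 / 4 : ℝ) ^ 21) ^ 2 / (4 * (((k : ℝ) + 85 / 4) * ((k : ℝ) + 85 / 4 + 1))) by
      field_simp]
    exact div_le_div₀ (by positivity) hnum1 hden0 hden
  rw [hTval] at htail
  have htailnum : (0.01176 : ℝ) ≤ (1 - (1 / 4 : ℝ) ^ 21) ^ 2 / 4 * (1 / (85 / 4)) := by norm_num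
  have hsub : 4 * (r - 1) ^ 2 < 0.686293 := by nlinarith
  have hprime := prime_terms_log_two_gt
  linarith

/-! ### Assembly -/

/-- **Anti-persistence on `[(log 3)/2, log 2]`** (primes `2, 3` acting on `Ψ(2s)`): `Ψ(2s) < 2Ψ(s)`, by concavity of
`D + affine` between the certified end-points `(log 3)/2` (p443658) and `log 2`. [folklore] -/
theorem zetaScrew_two_mul_lt_two_mul_of_half_log_three_le {s : ℝ} (h0 : Real.log 3 / 2 ≤ s)
    (h1 : s ≤ Real.log 2) : zetaScrew (2 * s) < 2 * zetaScrew s := by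
  have hl2 : 0 < Real.log 2 := Real.log_pos one_lt_two
  have h23 : Real.log 2 < Real.log 3 := Real.log_lt_log (by norm_num) (by norm_num)
  have h34 : Real.log 3 < 2 * Real.log 2 := by
    have h' : Real.log 3 < Real.log 4 := Real.log_lt_log (by norm_num) (by norm_num)
    have h4 : Real.log 4 = 2 * Real.log 2 := by
      rw [show (4 : ℝ) = 2 ^ 2 by norm_num, Real.log_pow]; norm_num
    linarith
  have h44 : Real.log 4 = 2 * Real.log 2 := by
    rw [show (4 : ℝ) = 2 ^ 2 by norm_num, Real.log_pow]; norm_num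
  set s₀ : ℝ := Real.log 3 / 2 with hs₀
  set s₁ : ℝ := Real.log 2 with hs₁
  have hd : 0 < s₁ - s₀ := by rw [hs₀, hs₁]; linarith
  set a : ℝ := (s₁ - s) / (s₁ - s₀) with ha
  set b : ℝ := (s - s₀) / (s₁ - s₀) with hb
  have ha0 : 0 ≤ a := div_nonneg (by linarith) hd.le
  have hb0 : 0 ≤ b := div_nonneg (by linarith) hd.le
  have hab : a + b = 1 := by rw [ha, hb, ← add_div, div_eq_one_iff_eq hd.ne']; ring
  have hs : a * s₀ + b * s₁ = s := by
    rw [ha, hb]; field_simp; ring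
  -- concavity of `D + (log 2/√2)(2s − log 2)`; the `(log 3/√3)(2s − log 3)` term is affine
  have hc := gap_add_prime_concave (x := s₀) (y := s₁) (by rw [hs₀]; linarith) (by rw [hs₁]; linarith)
    ha0 hb0 hab
  rw [hs] at hc
  have hlin : a * (Real.log 3 / Real.sqrt 3 * (2 * s₀ - Real.log 3))
      + b * (Real.log 3 / Real.sqrt 3 * (2 * s₁ - Real.log 3))
      = Real.log 3 / Real.sqrt 3 * (2 * s - Real.log 3) := by
    have hb' : b = 1 - a := by linarith
    rw [← hs, hb']; ring
  -- end values
  have hF0 : 0 < (∑' k : ℕ, (1 - Real.exp (-((2 * (k : ℝ) + 5 / 2) * s₀))) ^ 2 / (2 * (k : ℝ) + 5 / 2) ^ 2)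
      - 4 * (Real.exp (s₀ / 2) - 1) ^ 2 + Real.log 2 / Real.sqrt 2 * (2 * s₀ - Real.log 2)
      + Real.log 3 / Real.sqrt 3 * (2 * s₀ - Real.log 3) := by
    have h := gap_add_prime_half_log_three_pos
    have hz : Real.log 3 / Real.sqrt 3 * (2 * s₀ - Real.log 3) = 0 := by rw [hs₀]; ring
    rw [hz, add_zero]
    exact h
  have hF1 : 0 < (∑' k : ℕ, (1 - Real.exp (-((2 * (k : ℝ) + 5 / 2) * s₁))) ^ 2 / (2 * (k : ℝ) + 5 / 2) ^ 2)
      - 4 * (Real.exp (s₁ / 2) - 1) ^ 2 + Real.log 2 / Real.sqrt 2 * (2 * s₁ - Real.log 2)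
      + Real.log 3 / Real.sqrt 3 * (2 * s₁ - Real.log 3) :=
    gap_add_primes_log_two_pos
  have hid := two_mul_zetaScrew_sub_eq_gap_add_two_primes (s := s) (by rw [hs₀] at h0; linarith)
    (by rw [h44]; rw [hs₁] at h1; linarith)
  -- `a·F(s₀) + b·F(s₁) > 0`
  have hmin : 0 < a * ((∑' k : ℕ, (1 - Real.exp (-((2 * (k : ℝ) + 5 / 2) * s₀))) ^ 2
        / (2 * (k : ℝ) + 5 / 2) ^ 2)
      - 4 * (Real.exp (s₀ / 2) - 1) ^ 2 + Real.log 2 / Real.sqrt 2 * (2 * s₀ - Real.log 2)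
      + Real.log 3 / Real.sqrt 3 * (2 * s₀ - Real.log 3))
      + b * ((∑' k : ℕ, (1 - Real.exp (-((2 * (k : ℝ) + 5 / 2) * s₁))) ^ 2
        / (2 * (k : ℝ) + 5 / 2) ^ 2)
      - 4 * (Real.exp (s₁ / 2) - 1) ^ 2 + Real.log 2 / Real.sqrt 2 * (2 * s₁ - Real.log 2)
      + Real.log 3 / Real.sqrt 3 * (2 * s₁ - Real.log 3)) := by
    rcases le_total a b with hab' | hab'
    · have hb2 : 1 / 2 ≤ b := by linarith
      nlinarith [mul_nonneg ha0 hF0.le, mul_le_mul_of_nonneg_right hb2 hF1.le]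
    · have ha2 : 1 / 2 ≤ a := by linarith
      nlinarith [mul_nonneg hb0 hF1.le, mul_le_mul_of_nonneg_right ha2 hF0.le]
  linarith

/-- **Anti-persistence of the zeta screw line for every mesh up to `log 2`** (RH-FREE calculus inequality):
`Ψ(2s) < 2Ψ(s)` for every `0 < s ≤ log 2`. [folklore] -/
theorem zetaScrew_two_mul_lt_two_mul_of_le_log_two {s : ℝ} (hs0 : 0 < s) (hs : s ≤ Real.log 2) :
    zetaScrew (2 * s) < 2 * zetaScrew s := by
  rcases le_total s (Real.log 3 / 2) with h | h
  · exact zetaScrew_two_mul_lt_two_mul_of_le_half_log_three hs0 h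
  · exact zetaScrew_two_mul_lt_two_mul_of_half_log_three_le h hs

/-- **`κ₁(s) > 0` for every mesh up to `log 2`**: `0 < 1 − Ψ(2s)/(2Ψ(s))`, `0 < s ≤ log 2` (unconditionally,
`Suzuki2023Thm41.zetaScrew_pos_of_le_log_two`). [folklore] -/
theorem kappaOne_pos_of_le_log_two {s : ℝ} (hs0 : 0 < s) (hs : s ≤ Real.log 2) :
    0 < 1 - zetaScrew (2 * s) / (2 * zetaScrew s) := by
  have h := zetaScrew_two_mul_lt_two_mul_of_le_log_two hs0 hs
  have hpos : 0 < zetaScrew s := Suzuki2023Thm41.zetaScrew_pos_of_le_log_two hs0 hs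
  have h2 : 0 < 2 * zetaScrew s := by linarith
  rw [sub_pos, div_lt_one h2]
  exact h

end Summit.RiemannHypothesis.RiemannHypothesis.Theorems.DbrWall
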